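import Summits.CriticalPhenomena.SAWScalingLimit.Theorems.SAWLeftRightFKGLeftRightFKGRectBoundaryWalk
import Summits.CriticalPhenomena.SAWScalingLimit.Theorems.SAWLeftRightFKGLeftRightFKGCornerMinorOfIneq
import Summits.CriticalPhenomena.SAWScalingLimit.Theorems.SAWLeftRightFKGLeftRightFKGCorner65Cert
import HarnessLib

/-!
# Left–right association FAILS at every fugacity `0.52 ≤ x ≤ 1` (crux `LeftRightFKG`, lead c4): the certified edge pushed to `13/25`

Companion of `…NotPAOfGe.lean` (`not_PA_of_ge`: failure on `[0.61, 1]` from the `5 × 4` notched box). Here the `6 × 5` BOX with the marked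
points at its two bottom corners: `PA x` makes `{first step North}`, `{last step from the North}` up-closed and yields one inequality which
the class dictionary reads as the TP₂ corner minor `Z_G(u₂,w₁)Z_G(u₁,w₂) ≤ Z_G(u₁,w₁)Z_G(u₂,w₂)` of the fugacity-`x` kernel of the free graph
(`Families.stub_cornerMinorOfIneq`), while the certificate `Families.stub_corner65Cert` (exact path-count polynomials: 443 473 paths from
`u₁ = (2,1)`; crossed − nested `= −x⁸ − 11x¹⁰ − 66x¹² − 267x¹⁴ − 316x¹⁶ + 2972x¹⁸ + …`, root in `(0.50, 0.51)`; `PolyMP.posOn` on `[13/25, 1]`,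
`native_decide`) gives the reverse strict inequality: **`¬ CornerLoc.PA x` for every `13/25 ≤ x ≤ 1`**. The realisation of the box as a
crux domain is `Families.stub_rectBoundaryWalk` + `Negative.Rect.dAdj_iff`. (x_c ≈ 0.379; exact thresholds of this minor family:
`.555 / .53 / .505 / .49` for `5×4 / 5×5 / 6×5 / 6×6`.) Everything proved ("folklore"; the certificate is a `--computational` landing).
-/

noncomputable section

open MeasureTheory
open Literature.Probability.LatticeModels Literature.Probability.RandomPlanarGeometry
open Summit.CriticalPhenomena.SAWScalingLimit.Theorems.LeftRightFKG.Negative (bx pathCross wcross)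
open Summit.CriticalPhenomena.SAWScalingLimit.Theorems.LeftRightFKG.CornerLoc
open Summit.CriticalPhenomena.SAWScalingLimit.Theorems.BoundaryTP2 (pathKernel pathKernelOn)
open scoped Classical ENNReal

namespace Summit.CriticalPhenomena.SAWScalingLimit.Theorems.LeftRightFKG.Families

/-- **Left–right association fails at every fugacity `13/25 ≤ x ≤ 1`** (`CornerLoc.PA x` is false there): the `6 × 5` box with marked
bottom corners, corner-minor bookkeeping `stub_cornerMinorOfIneq`, certificate `stub_corner65Cert`. [folklore] -/
theorem not_PA_of_ge_052 : ∀ (x : ℝ), (13 / 25 : ℝ) ≤ x → x ≤ 1 → ¬ PA x := by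
  intro x hlo hhi hPA
  have hx : 0 < x := lt_of_lt_of_le (by norm_num) hlo
  obtain ⟨C, hb, hch, hcomp, hcross⟩ := stub_rectBoundaryWalk 0 7 0 6 (by norm_num) (by norm_num)
  have hface : (0 : ℤ) ≤ 0 ∧ (0 : ℤ) + 1 ≤ 7 ∧ (0 : ℤ) ≤ 0 ∧ (0 : ℤ) + 1 ≤ 6 := by norm_num
  have hcross' : pathCross 0 0 (bx 0 0) C.support.tail ≠ 0 := by rw [hcross]; decide
  have hdom : dom C 1 = Negative.Rect.Ω C := rfl
  have hadj : ∀ u w : Site 2, (discreteDomainGraph (dom C 1) 1).Adj u w ↔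
      (zdGraph 2).Adj u w ∧ u ∈ Negative.Rect.box 0 7 0 6 ∧ w ∈ Negative.Rect.box 0 7 0 6 := fun u w => by
    rw [hdom]; exact Negative.Rect.dAdj_iff hb hch hcomp hface hcross'
  obtain ⟨⟨hE, hF⟩, hbook⟩ := stub_cornerMinorOfIneq x 0 7 0 6 C hx (by norm_num) (by norm_num) hadj
  have hInst : IsInst 1 (bx (0 + 1) (0 + 1)) (bx (7 - 1) (0 + 1)) (bx (0 + 1) 0) (bx (7 - 1) 0) C :=
    ⟨one_pos, hcomp _ _ (by norm_num) (by norm_num) le_rfl (by norm_num) (Or.inr (Or.inr (Or.inl rfl))),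
      hcomp _ _ (by norm_num) (by norm_num) le_rfl (by norm_num) (Or.inr (Or.inr (Or.inl rfl))),
      Negative.adj_bx _ _ _ _ (by norm_num), Negative.adj_bx _ _ _ _ (by norm_num)⟩
  have key := hPA 1 (bx 0 0) (bx (0 + 1) (0 + 1)) (bx (7 - 1) (0 + 1)) (bx (0 + 1) 0) (bx (7 - 1) 0) C hInst
    0 (fun _ => bx (0 + 1) (0 + 1)) 0 (fun _ => bx (7 - 1) (0 + 1)) Set.univ Set.univ _ _
    (isUpOn_of_isUp hE) (isUpOn_of_isUp hF) (by simp) (by simp)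
  simp only [restrP_zero_univ, Set.inter_univ] at key
  have hmin := hbook key _ rfl
  have hG : ∀ p q : Site 2, (freeGraph (dom C 1) 1 0 (fun _ => bx (0 + 1) (0 + 1)) 0 (fun _ => bx (7 - 1) (0 + 1))).Adj p q ↔
      (zdGraph 2).Adj p q ∧ p ∈ Negative.Rect.box 0 7 0 6 \ {bx 1 1, bx 6 1} ∧
        q ∈ Negative.Rect.box 0 7 0 6 \ {bx 1 1, bx 6 1} := by
    intro p q
    rw [freeGraph_adj, hadj]
    have hfix : ∀ w : Site 2, w ∈ fixedSet 0 (fun _ => bx (0 + 1) (0 + 1)) 0 (fun _ => bx (7 - 1) (0 + 1)) ↔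
        w = bx 1 1 ∨ w = bx 6 1 := by
      intro w
      simp only [fixedSet, Set.mem_setOf_eq, Nat.le_zero, exists_eq_left]
      constructor
      · rintro (h | h) <;> [left; right] <;> rw [← h] <;> rfl
      · rintro (rfl | rfl) <;> [left; right] <;> rfl
    simp only [hfix, Set.mem_sdiff, Set.mem_insert_iff, Set.mem_singleton_iff, not_or]
    tauto
  have hcert := stub_corner65Cert _ x hG hlo hhi
  have e1 : bx (0 + 1) (0 + 2) = bx 1 2 := rfl
  have e2 : bx (7 - 2) (0 + 1) = bx 5 1 := rfl
  have e3 : bx (0 + 2) (0 + 1) = bx 2 1 := rfl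
  have e4 : bx (7 - 1) (0 + 2) = bx 6 2 := rfl
  rw [e1, e2, e3, e4] at hmin
  exact absurd hmin (not_le.2 hcert)

end Summit.CriticalPhenomena.SAWScalingLimit.Theorems.LeftRightFKG.Families

end
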